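import Mathlib
import Summits.Ventures.PercRepro2.TwoHullMasterPath
import Summits.Ventures.PercRepro2.SwGlue2

/-!
# The two-hull master statement across a two-vertex cut `{l, h}` from side involutions (blind cell
PercRepro2, night-4 g39, 2026-08-29; proofs/NIGHT4-G39.md §7, Theorem 2)

A SIDE INVOLUTION of a graph with marks `l ≠ h` (`SideInvolution ends l h τ c`): an involution `τ`
of the configurations with no monochromatic `l`–`h` connection which MIRRORS the hull pair of `l`
and moves the hull pair of `h` up or down according to a colour `c ζ`, the colour also fixing the
side of the diamond (the hull pair of `l` dominates its swap when `c ζ = true`, is dominated by it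
when `c ζ = false`).  The interface involution `flipHead` of a path is one (TwoHullMasterPath2.lean).
THEOREM (**`twoHullMaster_glue2`**): if both sides of a two-vertex cut `{l, h}` (`Glue2.IsGluing2`)
carry side involutions, (MM) holds for the glued graph.  PROOF.  On `U` the hull pairs of the
glued graph are the unions of the side pairs (`cluster_glue2_l`, `cluster_h_of_not_mem`); the
group generated by the two side involutions acts on `U` with orbits `{ζ, T₁ζ, T₂ζ, T₁T₂ζ}`, and
with `a = X ζ`, `b = X (T₁ ζ)` the orbit sum of `Φ = X·Y` is
`−½ [(a − b)(Y₁ − Y₀) + (a + b)(Y₁₂ − Y₁) + (a + b)(Y₂ − Y₀) + (a − b)(Y₁₂ − Y₂)]`, where each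
product is ≥ 0: `a − b` has the sign of `c₁` (the diamond of side 1 inside the union), `a + b` the
sign of `c₂`, and every `Y`-difference is a one-side move in the direction of the same colour.
So `4 Σ_U Φ ≤ 0`, and the four-count identity (`twoHullMaster_of_sum_nonpos`) gives (MM).

* `twoHullMaster_of_sum_nonpos` — (MM) from the signed sums (any graph);
* `SideInvolution`; `pairUnion`, `pairUnion_swap`, `PairLE.union`;
* `hullPair_glue2_l`, `hullPair_glue2_h`, `notMem_hull_glue2_iff`;
* `orbit_sum_nonpos` — the orbit inequality; **`twoHullMaster_glue2`**.
-/

namespace Summit.Ventures.PercRepro2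

namespace Glue2

open Hull LocRows Path2

open scoped Classical

variable {V : Type*}

/-! ## §1 (MM) from the signed sums, on any graph -/

section Generic

variable {E : Type*} [Fintype E] [DecidableEq E] (ends : E → Sym2 V)

/-- The configurations with `h ∉ H_l`. -/
noncomputable def uClass (l h : V) : Finset (Config E) :=
  Finset.univ.filter fun ζ => h ∉ hull ends ζ l

/-- The signed summand `X·Y` of a configuration, on any graph. -/
noncomputable def phiG (l h : V) (𝓦l 𝓦h : Set (Set V × Set V)) (ζ : Config E) : ℤ :=
  sgn 𝓦l (hullPair ends ζ l) * sgn 𝓦h (hullPair ends ζ h)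

variable {ends}

/-- Membership in `uClass`. -/
lemma mem_uClass {l h : V} {ζ : Config E} : ζ ∈ uClass ends l h ↔ h ∉ hull ends ζ l := by
  simp only [uClass, Finset.mem_filter, Finset.mem_univ, true_and]

/-- The two-hull class is `uClass` filtered by the pairs. -/
lemma twoHullClass_eq_uClass_filter (l h : V) (𝓦l 𝓦h : Set (Set V × Set V)) :
    twoHullClass ends l h 𝓦l 𝓦h =
      (uClass ends l h).filter fun ζ => hullPair ends ζ l ∈ 𝓦l ∧ hullPair ends ζ h ∈ 𝓦h := by
  ext ζ
  rw [mem_twoHullClass, Finset.mem_filter, mem_uClass]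

/-- The signed sum in terms of the four two-hull counts. -/
lemma sum_phiG_eq (l h : V) (𝓦l 𝓦h : Set (Set V × Set V)) :
    ∑ ζ ∈ uClass ends l h, phiG ends l h 𝓦l 𝓦h ζ =
      ((twoHullClass ends l h 𝓦l 𝓦h).card : ℤ)
        - ((twoHullClass ends l h 𝓦l (mirror 𝓦h)).card : ℤ)
        - ((twoHullClass ends l h (mirror 𝓦l) 𝓦h).card : ℤ)
        + ((twoHullClass ends l h (mirror 𝓦l) (mirror 𝓦h)).card : ℤ) := by
  have key : ∀ ζ, phiG ends l h 𝓦l 𝓦h ζ =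
      (if (hullPair ends ζ l ∈ 𝓦l ∧ hullPair ends ζ h ∈ 𝓦h) then (1 : ℤ) else 0)
      - (if (hullPair ends ζ l ∈ 𝓦l ∧ hullPair ends ζ h ∈ mirror 𝓦h) then (1 : ℤ) else 0)
      - (if (hullPair ends ζ l ∈ mirror 𝓦l ∧ hullPair ends ζ h ∈ 𝓦h) then (1 : ℤ) else 0)
      + (if (hullPair ends ζ l ∈ mirror 𝓦l ∧ hullPair ends ζ h ∈ mirror 𝓦h) then (1 : ℤ) else 0) := by
    intro ζ
    simp only [phiG, sgn, ind_swap]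
    rw [← ind_mul_ind, ← ind_mul_ind, ← ind_mul_ind, ← ind_mul_ind]
    ring
  simp_rw [key]
  rw [Finset.sum_add_distrib, Finset.sum_sub_distrib, Finset.sum_sub_distrib]
  simp only [Finset.sum_boole, twoHullClass_eq_uClass_filter]

/-- **(MM) from the signed sums**: if `Σ_U X·Y ≤ 0` for all up-sets, (MM) holds. -/
theorem twoHullMaster_of_sum_nonpos (l h : V)
    (hs : ∀ 𝓦l 𝓦h : Set (Set V × Set V), IsPairUpSet 𝓦l → IsPairUpSet 𝓦h →
      ∑ ζ ∈ uClass ends l h, phiG ends l h 𝓦l 𝓦h ζ ≤ 0) :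
    TwoHullMaster ends l h := by
  intro 𝓦l 𝓦h h𝓦l h𝓦h
  have hsum := hs 𝓦l 𝓦h h𝓦l h𝓦h
  rw [sum_phiG_eq] at hsum
  have e1 := card_twoHullClass_mirror_mirror (ends := ends) l h 𝓦l 𝓦h
  have e2 := card_twoHullClass_mirror_mirror (ends := ends) l h 𝓦l (mirror 𝓦h)
  rw [mirror_mirror] at e2
  omega

end Generic

/-! ## §2 Side involutions -/

/-- The union of two pairs, coordinatewise. -/
def pairUnion (q q' : Set V × Set V) : Set V × Set V := (q.1 ∪ q'.1, q.2 ∪ q'.2)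

/-- The swap of a union is the union of the swaps. -/
lemma pairUnion_swap (q q' : Set V × Set V) : (pairUnion q q').swap = pairUnion q.swap q'.swap := rfl

/-- The union is monotone in each argument. -/
lemma PairLE.union {q q' r r' : Set V × Set V} (h : PairLE q q') (h' : PairLE r r') :
    PairLE (pairUnion q r) (pairUnion q' r') :=
  ⟨Set.union_subset_union h.1 h'.1, Set.union_subset_union h.2 h'.2⟩

/-- The pair order is reflexive. -/
lemma PairLE.refl (q : Set V × Set V) : PairLE q q := ⟨le_rfl, le_rfl⟩

/-- **A side involution**: an involution `τ` of the configurations with `h ∉ H_l` that mirrors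
the hull pair of `l`, moves the hull pair of `h` in the direction of the colour `c`, and whose
colour fixes the side of the diamond at `l`. -/
structure SideInvolution {E : Type*} (ends : E → Sym2 V) (l h : V) (τ : Config E → Config E)
    (c : Config E → Bool) : Prop where
  mem : ∀ ζ, h ∉ hull ends ζ l → h ∉ hull ends (τ ζ) l
  invol : ∀ ζ, h ∉ hull ends ζ l → τ (τ ζ) = ζ
  l_mirror : ∀ ζ, h ∉ hull ends ζ l → hullPair ends (τ ζ) l = (hullPair ends ζ l).swap
  h_up : ∀ ζ, h ∉ hull ends ζ l → c ζ = true → PairLE (hullPair ends ζ h) (hullPair ends (τ ζ) h)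
  h_down : ∀ ζ, h ∉ hull ends ζ l → c ζ = false →
    PairLE (hullPair ends (τ ζ) h) (hullPair ends ζ h)
  diamond_up : ∀ ζ, h ∉ hull ends ζ l → c ζ = true →
    PairLE (hullPair ends ζ l).swap (hullPair ends ζ l)
  diamond_down : ∀ ζ, h ∉ hull ends ζ l → c ζ = false →
    PairLE (hullPair ends ζ l) (hullPair ends ζ l).swap

/-! ## §3 The pairs of the glued graph -/

variable {E₁ E₂ : Type*} {ends₁ : E₁ → Sym2 V} {ends₂ : E₂ → Sym2 V} {l h : V} {V₁ V₂ : Set V}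

/-- `h ∉ H_l` in the glued graph iff on both sides. -/
lemma notMem_hull_glue2_iff (hg : IsGluing2 ends₁ ends₂ l h V₁ V₂) (ζ : Config (E₁ ⊕ E₂)) :
    h ∉ hull (glue2 ends₁ ends₂) ζ l ↔
      h ∉ hull ends₁ (ζ ∘ Sum.inl) l ∧ h ∉ hull ends₂ (ζ ∘ Sum.inr) l := by
  simp only [mem_hull_iff, h_mem_cluster_glue2_iff hg, blue_comp_inl, blue_comp_inr]
  tauto

/-- On `U` the hull pair of `l` is the union of the side pairs. -/
lemma hullPair_glue2_l (hg : IsGluing2 ends₁ ends₂ l h V₁ V₂) {ζ : Config (E₁ ⊕ E₂)}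
    (hU : h ∉ hull (glue2 ends₁ ends₂) ζ l) :
    hullPair (glue2 ends₁ ends₂) ζ l =
      pairUnion (hullPair ends₁ (ζ ∘ Sum.inl) l) (hullPair ends₂ (ζ ∘ Sum.inr) l) := by
  rw [notMem_hull_glue2_iff hg] at hU
  simp only [mem_hull_iff, not_or] at hU
  have h1 : cluster (glue2 ends₁ ends₂) ζ l =
      cluster ends₁ (ζ ∘ Sum.inl) l ∪ cluster ends₂ (ζ ∘ Sum.inr) l :=
    cluster_glue2_l hg (by rw [Set.mem_union, not_or]; exact ⟨hU.1.1, hU.2.1⟩)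
  have h2 : cluster (glue2 ends₁ ends₂) (blue ζ) l =
      cluster ends₁ (blue (ζ ∘ Sum.inl)) l ∪ cluster ends₂ (blue (ζ ∘ Sum.inr)) l := by
    rw [cluster_glue2_l hg (by rw [Set.mem_union, not_or, blue_comp_inl, blue_comp_inr]; exact ⟨hU.1.2, hU.2.2⟩)]
    rw [blue_comp_inl, blue_comp_inr]
  simp only [hullPair, pairUnion, h1, h2]

/-- On `U` the hull pair of `h` is the union of the side pairs. -/
lemma hullPair_glue2_h (hg : IsGluing2 ends₁ ends₂ l h V₁ V₂) {ζ : Config (E₁ ⊕ E₂)}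
    (hU : h ∉ hull (glue2 ends₁ ends₂) ζ l) :
    hullPair (glue2 ends₁ ends₂) ζ h =
      pairUnion (hullPair ends₁ (ζ ∘ Sum.inl) h) (hullPair ends₂ (ζ ∘ Sum.inr) h) := by
  simp only [mem_hull_iff, not_or] at hU
  have h1 := cluster_h_of_not_mem hg hU.1
  have h2 := cluster_h_of_not_mem hg hU.2
  rw [blue_comp_inl, blue_comp_inr] at h2
  simp only [hullPair, pairUnion, h1, h2]

/-! ## §4 The orbit inequality and the theorem -/

section Orbit

variable {τ₁ : Config E₁ → Config E₁} {c₁ : Config E₁ → Bool} {τ₂ : Config E₂ → Config E₂}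
  {c₂ : Config E₂ → Bool}

/-- The first side involution on the glued graph. -/
def act₁ (τ₁ : Config E₁ → Config E₁) (ζ : Config (E₁ ⊕ E₂)) : Config (E₁ ⊕ E₂) :=
  pair2 (τ₁ (ζ ∘ Sum.inl)) (ζ ∘ Sum.inr)

/-- The second side involution on the glued graph. -/
def act₂ (τ₂ : Config E₂ → Config E₂) (ζ : Config (E₁ ⊕ E₂)) : Config (E₁ ⊕ E₂) :=
  pair2 (ζ ∘ Sum.inl) (τ₂ (ζ ∘ Sum.inr))

/-- The first side of `act₁`. -/
lemma act₁_inl (ζ : Config (E₁ ⊕ E₂)) : act₁ τ₁ ζ ∘ Sum.inl = τ₁ (ζ ∘ Sum.inl) := rfl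
/-- The second side of `act₁`. -/
lemma act₁_inr (ζ : Config (E₁ ⊕ E₂)) : act₁ τ₁ ζ ∘ Sum.inr = ζ ∘ Sum.inr := rfl
/-- The first side of `act₂`. -/
lemma act₂_inl (ζ : Config (E₁ ⊕ E₂)) : act₂ τ₂ ζ ∘ Sum.inl = ζ ∘ Sum.inl := rfl
/-- The second side of `act₂`. -/
lemma act₂_inr (ζ : Config (E₁ ⊕ E₂)) : act₂ τ₂ ζ ∘ Sum.inr = τ₂ (ζ ∘ Sum.inr) := rfl

/-- The actions preserve `U`. -/
lemma act₁_mem (hg : IsGluing2 ends₁ ends₂ l h V₁ V₂) (h₁ : SideInvolution ends₁ l h τ₁ c₁)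
    {ζ : Config (E₁ ⊕ E₂)} (hU : h ∉ hull (glue2 ends₁ ends₂) ζ l) :
    h ∉ hull (glue2 ends₁ ends₂) (act₁ τ₁ ζ) l := by
  rw [notMem_hull_glue2_iff hg] at hU ⊢
  rw [act₁_inl, act₁_inr]
  exact ⟨h₁.mem _ hU.1, hU.2⟩

/-- The second action preserves `U`. -/
lemma act₂_mem (hg : IsGluing2 ends₁ ends₂ l h V₁ V₂) (h₂ : SideInvolution ends₂ l h τ₂ c₂)
    {ζ : Config (E₁ ⊕ E₂)} (hU : h ∉ hull (glue2 ends₁ ends₂) ζ l) :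
    h ∉ hull (glue2 ends₁ ends₂) (act₂ τ₂ ζ) l := by
  rw [notMem_hull_glue2_iff hg] at hU ⊢
  rw [act₂_inl, act₂_inr]
  exact ⟨hU.1, h₂.mem _ hU.2⟩

/-- The actions are involutions on `U`. -/
lemma act₁_act₁ (hg : IsGluing2 ends₁ ends₂ l h V₁ V₂) (h₁ : SideInvolution ends₁ l h τ₁ c₁)
    {ζ : Config (E₁ ⊕ E₂)} (hU : h ∉ hull (glue2 ends₁ ends₂) ζ l) :
    act₁ τ₁ (act₁ τ₁ ζ) = ζ := by
  rw [notMem_hull_glue2_iff hg] at hU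
  simp only [act₁, pair2_inl, pair2_inr, h₁.invol _ hU.1, pair2_sides]

/-- The second action is an involution on `U`. -/
lemma act₂_act₂ (hg : IsGluing2 ends₁ ends₂ l h V₁ V₂) (h₂ : SideInvolution ends₂ l h τ₂ c₂)
    {ζ : Config (E₁ ⊕ E₂)} (hU : h ∉ hull (glue2 ends₁ ends₂) ζ l) :
    act₂ τ₂ (act₂ τ₂ ζ) = ζ := by
  rw [notMem_hull_glue2_iff hg] at hU
  simp only [act₂, pair2_inl, pair2_inr, h₂.invol _ hU.2, pair2_sides]

/-- The two actions commute. -/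
lemma act₁_act₂ (ζ : Config (E₁ ⊕ E₂)) : act₁ τ₁ (act₂ τ₂ ζ) = act₂ τ₂ (act₁ τ₁ ζ) := rfl

/-- **The orbit inequality**: the sum of `Φ` over `{ζ, T₁ζ, T₂ζ, T₁T₂ζ}` is non-positive. -/
theorem orbit_sum_nonpos (hg : IsGluing2 ends₁ ends₂ l h V₁ V₂)
    (h₁ : SideInvolution ends₁ l h τ₁ c₁) (h₂ : SideInvolution ends₂ l h τ₂ c₂)
    {𝓦l 𝓦h : Set (Set V × Set V)} (h𝓦l : IsPairUpSet 𝓦l) (h𝓦h : IsPairUpSet 𝓦h)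
    {ζ : Config (E₁ ⊕ E₂)} (hU : h ∉ hull (glue2 ends₁ ends₂) ζ l) :
    phiG (glue2 ends₁ ends₂) l h 𝓦l 𝓦h ζ + phiG (glue2 ends₁ ends₂) l h 𝓦l 𝓦h (act₁ τ₁ ζ) +
      phiG (glue2 ends₁ ends₂) l h 𝓦l 𝓦h (act₂ τ₂ ζ) +
      phiG (glue2 ends₁ ends₂) l h 𝓦l 𝓦h (act₁ τ₁ (act₂ τ₂ ζ)) ≤ 0 := by
  have hU1 := act₁_mem hg h₁ hU
  have hU2 := act₂_mem hg h₂ hU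
  have hU12 := act₁_mem hg h₁ hU2
  have hUs := (notMem_hull_glue2_iff hg ζ).1 hU
  -- the side pairs
  set q₁ := hullPair ends₁ (ζ ∘ Sum.inl) l with hq₁
  set q₂ := hullPair ends₂ (ζ ∘ Sum.inr) l with hq₂
  set t₁ := hullPair ends₁ (ζ ∘ Sum.inl) h with ht₁
  set t₂ := hullPair ends₂ (ζ ∘ Sum.inr) h with ht₂
  set t₁' := hullPair ends₁ (τ₁ (ζ ∘ Sum.inl)) h with ht₁'
  set t₂' := hullPair ends₂ (τ₂ (ζ ∘ Sum.inr)) h with ht₂'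
  -- the pairs of the four points
  have e0l : hullPair (glue2 ends₁ ends₂) ζ l = pairUnion q₁ q₂ := hullPair_glue2_l hg hU
  have e1l : hullPair (glue2 ends₁ ends₂) (act₁ τ₁ ζ) l = pairUnion q₁.swap q₂ := by
    rw [hullPair_glue2_l hg hU1, act₁_inl, act₁_inr, h₁.l_mirror _ hUs.1]
  have e2l : hullPair (glue2 ends₁ ends₂) (act₂ τ₂ ζ) l = pairUnion q₁ q₂.swap := by
    rw [hullPair_glue2_l hg hU2, act₂_inl, act₂_inr, h₂.l_mirror _ hUs.2]
  have e12l : hullPair (glue2 ends₁ ends₂) (act₁ τ₁ (act₂ τ₂ ζ)) l =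
      pairUnion q₁.swap q₂.swap := by
    rw [hullPair_glue2_l hg hU12, act₁_inl, act₁_inr, act₂_inl, act₂_inr, h₁.l_mirror _ hUs.1,
      h₂.l_mirror _ hUs.2]
  have e0h : hullPair (glue2 ends₁ ends₂) ζ h = pairUnion t₁ t₂ := hullPair_glue2_h hg hU
  have e1h : hullPair (glue2 ends₁ ends₂) (act₁ τ₁ ζ) h = pairUnion t₁' t₂ := by
    rw [hullPair_glue2_h hg hU1, act₁_inl, act₁_inr]
  have e2h : hullPair (glue2 ends₁ ends₂) (act₂ τ₂ ζ) h = pairUnion t₁ t₂' := by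
    rw [hullPair_glue2_h hg hU2, act₂_inl, act₂_inr]
  have e12h : hullPair (glue2 ends₁ ends₂) (act₁ τ₁ (act₂ τ₂ ζ)) h = pairUnion t₁' t₂' := by
    rw [hullPair_glue2_h hg hU12, act₁_inl, act₁_inr, act₂_inl, act₂_inr]
  simp only [phiG, e0l, e1l, e2l, e12l, e0h, e1h, e2h, e12h]
  -- the signs `a = X ζ`, `b = X (T₁ ζ)`
  have hb2 : sgn 𝓦l (pairUnion q₁ q₂.swap) = - sgn 𝓦l (pairUnion q₁.swap q₂) := by
    rw [← sgn_swap, pairUnion_swap, Prod.swap_swap]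
  have ha2 : sgn 𝓦l (pairUnion q₁.swap q₂.swap) = - sgn 𝓦l (pairUnion q₁ q₂) := by
    rw [← sgn_swap, pairUnion_swap]
  rw [hb2, ha2]
  set a := sgn 𝓦l (pairUnion q₁ q₂) with ha
  set b := sgn 𝓦l (pairUnion q₁.swap q₂) with hb
  set b' := sgn 𝓦l (pairUnion q₁ q₂.swap) with hb'
  set Y₀ := sgn 𝓦h (pairUnion t₁ t₂)
  set Y₁ := sgn 𝓦h (pairUnion t₁' t₂)
  set Y₂ := sgn 𝓦h (pairUnion t₁ t₂')
  set Y₁₂ := sgn 𝓦h (pairUnion t₁' t₂')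
  -- the four products
  have P1 : 0 ≤ (a - b) * (Y₁ - Y₀) := by
    cases hc : c₁ (ζ ∘ Sum.inl) with
    | true =>
      have hab : b ≤ a := sgn_mono h𝓦l (PairLE.union (h₁.diamond_up _ hUs.1 hc) (PairLE.refl q₂))
      have hy : Y₀ ≤ Y₁ := sgn_mono h𝓦h (PairLE.union (h₁.h_up _ hUs.1 hc) (PairLE.refl t₂))
      nlinarith
    | false =>
      have hab : a ≤ b := sgn_mono h𝓦l (PairLE.union (h₁.diamond_down _ hUs.1 hc) (PairLE.refl q₂))
      have hy : Y₁ ≤ Y₀ := sgn_mono h𝓦h (PairLE.union (h₁.h_down _ hUs.1 hc) (PairLE.refl t₂))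
      nlinarith
  have P4 : 0 ≤ (a - b) * (Y₁₂ - Y₂) := by
    cases hc : c₁ (ζ ∘ Sum.inl) with
    | true =>
      have hab : b ≤ a := sgn_mono h𝓦l (PairLE.union (h₁.diamond_up _ hUs.1 hc) (PairLE.refl q₂))
      have hy : Y₂ ≤ Y₁₂ := sgn_mono h𝓦h (PairLE.union (h₁.h_up _ hUs.1 hc) (PairLE.refl t₂'))
      nlinarith
    | false =>
      have hab : a ≤ b := sgn_mono h𝓦l (PairLE.union (h₁.diamond_down _ hUs.1 hc) (PairLE.refl q₂))
      have hy : Y₁₂ ≤ Y₂ := sgn_mono h𝓦h (PairLE.union (h₁.h_down _ hUs.1 hc) (PairLE.refl t₂'))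
      nlinarith
  have P2 : 0 ≤ (a + b) * (Y₁₂ - Y₁) := by
    cases hc : c₂ (ζ ∘ Sum.inr) with
    | true =>
      have hab : b' ≤ a := sgn_mono h𝓦l (PairLE.union (PairLE.refl q₁) (h₂.diamond_up _ hUs.2 hc))
      have hy : Y₁ ≤ Y₁₂ := sgn_mono h𝓦h (PairLE.union (PairLE.refl t₁') (h₂.h_up _ hUs.2 hc))
      nlinarith
    | false =>
      have hab : a ≤ b' := sgn_mono h𝓦l (PairLE.union (PairLE.refl q₁) (h₂.diamond_down _ hUs.2 hc))
      have hy : Y₁₂ ≤ Y₁ := sgn_mono h𝓦h (PairLE.union (PairLE.refl t₁') (h₂.h_down _ hUs.2 hc))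
      nlinarith
  have P3 : 0 ≤ (a + b) * (Y₂ - Y₀) := by
    cases hc : c₂ (ζ ∘ Sum.inr) with
    | true =>
      have hab : b' ≤ a := sgn_mono h𝓦l (PairLE.union (PairLE.refl q₁) (h₂.diamond_up _ hUs.2 hc))
      have hy : Y₀ ≤ Y₂ := sgn_mono h𝓦h (PairLE.union (PairLE.refl t₁) (h₂.h_up _ hUs.2 hc))
      nlinarith
    | false =>
      have hab : a ≤ b' := sgn_mono h𝓦l (PairLE.union (PairLE.refl q₁) (h₂.diamond_down _ hUs.2 hc))
      have hy : Y₂ ≤ Y₀ := sgn_mono h𝓦h (PairLE.union (PairLE.refl t₁) (h₂.h_down _ hUs.2 hc))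
      nlinarith
  nlinarith [P1, P2, P3, P4]

/-- **(MM) across a two-vertex cut from side involutions.** -/
theorem twoHullMaster_glue2 (hg : IsGluing2 ends₁ ends₂ l h V₁ V₂)
    (h₁ : SideInvolution ends₁ l h τ₁ c₁) (h₂ : SideInvolution ends₂ l h τ₂ c₂)
    [Fintype E₁] [Fintype E₂] [DecidableEq E₁] [DecidableEq E₂] :
    TwoHullMaster (glue2 ends₁ ends₂) l h := by
  refine twoHullMaster_of_sum_nonpos l h fun 𝓦l 𝓦h h𝓦l h𝓦h => ?_
  set Φ := phiG (glue2 ends₁ ends₂) l h 𝓦l 𝓦h with hΦ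
  -- the three actions are bijections of `U`
  have s1 : ∑ ζ ∈ uClass (glue2 ends₁ ends₂) l h, Φ (act₁ τ₁ ζ) =
      ∑ ζ ∈ uClass (glue2 ends₁ ends₂) l h, Φ ζ := by
    refine Finset.sum_nbij' (act₁ τ₁) (act₁ τ₁) ?_ ?_ ?_ ?_ ?_
    · intro ζ hζ; rw [mem_uClass] at hζ ⊢; exact act₁_mem hg h₁ hζ
    · intro ζ hζ; rw [mem_uClass] at hζ ⊢; exact act₁_mem hg h₁ hζ
    · intro ζ hζ; rw [mem_uClass] at hζ; exact act₁_act₁ hg h₁ hζ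
    · intro ζ hζ; rw [mem_uClass] at hζ; exact act₁_act₁ hg h₁ hζ
    · intro ζ _; rfl
  have s2 : ∑ ζ ∈ uClass (glue2 ends₁ ends₂) l h, Φ (act₂ τ₂ ζ) =
      ∑ ζ ∈ uClass (glue2 ends₁ ends₂) l h, Φ ζ := by
    refine Finset.sum_nbij' (act₂ τ₂) (act₂ τ₂) ?_ ?_ ?_ ?_ ?_
    · intro ζ hζ; rw [mem_uClass] at hζ ⊢; exact act₂_mem hg h₂ hζ
    · intro ζ hζ; rw [mem_uClass] at hζ ⊢; exact act₂_mem hg h₂ hζ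
    · intro ζ hζ; rw [mem_uClass] at hζ; exact act₂_act₂ hg h₂ hζ
    · intro ζ hζ; rw [mem_uClass] at hζ; exact act₂_act₂ hg h₂ hζ
    · intro ζ _; rfl
  have s12 : ∑ ζ ∈ uClass (glue2 ends₁ ends₂) l h, Φ (act₁ τ₁ (act₂ τ₂ ζ)) =
      ∑ ζ ∈ uClass (glue2 ends₁ ends₂) l h, Φ ζ := by
    refine Finset.sum_nbij' (fun ζ => act₁ τ₁ (act₂ τ₂ ζ)) (fun ζ => act₂ τ₂ (act₁ τ₁ ζ)) ?_ ?_ ?_ ?_ ?_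
    · intro ζ hζ; rw [mem_uClass] at hζ ⊢; exact act₁_mem hg h₁ (act₂_mem hg h₂ hζ)
    · intro ζ hζ; rw [mem_uClass] at hζ ⊢; exact act₂_mem hg h₂ (act₁_mem hg h₁ hζ)
    · intro ζ hζ
      rw [mem_uClass] at hζ
      show act₂ τ₂ (act₁ τ₁ (act₁ τ₁ (act₂ τ₂ ζ))) = ζ
      rw [act₁_act₁ hg h₁ (act₂_mem hg h₂ hζ), act₂_act₂ hg h₂ hζ]
    · intro ζ hζ
      rw [mem_uClass] at hζ
      show act₁ τ₁ (act₂ τ₂ (act₂ τ₂ (act₁ τ₁ ζ))) = ζ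
      rw [act₂_act₂ hg h₂ (act₁_mem hg h₁ hζ), act₁_act₁ hg h₁ hζ]
    · intro ζ _; rfl
  have h4 : 4 * ∑ ζ ∈ uClass (glue2 ends₁ ends₂) l h, Φ ζ =
      ∑ ζ ∈ uClass (glue2 ends₁ ends₂) l h,
        (Φ ζ + Φ (act₁ τ₁ ζ) + Φ (act₂ τ₂ ζ) + Φ (act₁ τ₁ (act₂ τ₂ ζ))) := by
    rw [Finset.sum_add_distrib, Finset.sum_add_distrib, Finset.sum_add_distrib, s1, s2, s12]; ring
  have h5 : ∑ ζ ∈ uClass (glue2 ends₁ ends₂) l h,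
      (Φ ζ + Φ (act₁ τ₁ ζ) + Φ (act₂ τ₂ ζ) + Φ (act₁ τ₁ (act₂ τ₂ ζ))) ≤ 0 := by
    refine Finset.sum_nonpos fun ζ hζ => ?_
    rw [mem_uClass] at hζ
    exact orbit_sum_nonpos hg h₁ h₂ h𝓦l h𝓦h hζ
  omega

end Orbit

end Glue2

end Summit.Ventures.PercRepro2
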